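import Summits.MatrixMultiplication.OmegaCensus.STPPKernelListerCapstone
import Summits.MatrixMultiplication.OmegaCensus.STPPKernelListerKit

/-!
# ω-census (abelian STPP census): kernel lister — dead-list-free capstone kit (ORDER capstones valid for every abelian group of a given order) (kernel)

HONEST FRAMING (pub-omega census; verbatim): lottery ticket; floor = certified bounds/negative ranges.
Census STRUCTURE (seat pub-omega-stpp-2 gen 30, 2026-08-29), family (b2).  Nothing here is progress on `ω`.

The generic capstone `KLister.volume_le_of_scan` takes ANY finite abelian group `H` of order `n`; the only group-specific input is the dead list of
non-realisable size patterns.  When the kernel lister's root computation already returns `true` with the EMPTY dead list (the tree laws alone —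
single-block volume / representation count / N7 / N16 / N8 (Kneser over all divisors of `n`) / N18 / N12 — prune every beating pattern), the
conclusion «every STPP family of `H` has `Σ |Aᵢ||Bᵢ||Cᵢ| ≤ n`» holds for EVERY abelian group of order `n` at once.  This file packages that case:
`volume_le_of_scan_sel_nodead` (one covering first-block selection), `volume_le_of_scan_nodead` (no selection), `volume_le_of_scan_or_nodead`
(two selections glued by `scanFirstC_or`, for orders whose root computation is split in two kernel files).  Consumers: `STPPKernelListerOrderN*.lean`.
-/

open Finset

namespace Summit.MatrixMultiplication.OmegaCensus.KLister

open Literature.Computability.AlgebraicComplexity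

variable {H : Type*} [AddCommGroup H] [Fintype H] [DecidableEq H] {n : ℕ}

/-- **Dead-list-free capstone, one selection:** if the packed tables of the chunked shape list `L` of order `n` are certified, `L` lists exactly the
admissible shapes, the selection `sel` covers every listed shape, and the root computation `scanFirstC n [] sel L` returns `true`, then every STPP
family of every abelian group `H` of order `n` has volume `≤ n`. [cite: CohnKleinbergSzegedyUmans2005, Def. 5.1, Thm. 5.5] -/
theorem volume_le_of_scan_sel_nodead (hn : Fintype.card H = n) (hn0 : n ≠ 0) (L : List (List ℕ × List Shape)) (sel : Shape → Bool)
    (hcert : chunksOK (2 * n + 2) L = true) (hadm : ((flat L).all (adm n)) = true) (hflat : flat L = shapeList n)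
    (hsel : ((flat L).all sel) = true) (hscan : scanFirstC n [] sel L = true)
    {m : ℕ} (A B C : Fin m → Finset H) (hS : IsSTPP A B C) : ∑ i, #(A i) * #(B i) * #(C i) ≤ n :=
  volume_le_of_scan hn hn0 L [] sel (fun D hD => by simp at hD) hcert (fun s hs => List.all_eq_true.1 hadm s hs)
    (fun s hs => by rw [hflat]; exact mem_shapeList_of_adm hs) (fun s hs => List.all_eq_true.1 hsel s hs) hscan A B C hS

/-- **Dead-list-free capstone, no selection** (`sel = fun _ => true`). [cite: CohnKleinbergSzegedyUmans2005, Def. 5.1, Thm. 5.5] -/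
theorem volume_le_of_scan_nodead (hn : Fintype.card H = n) (hn0 : n ≠ 0) (L : List (List ℕ × List Shape))
    (hcert : chunksOK (2 * n + 2) L = true) (hadm : ((flat L).all (adm n)) = true) (hflat : flat L = shapeList n)
    (hscan : scanFirstC n [] (fun _ => true) L = true)
    {m : ℕ} (A B C : Fin m → Finset H) (hS : IsSTPP A B C) : ∑ i, #(A i) * #(B i) * #(C i) ≤ n :=
  volume_le_of_scan_sel_nodead hn hn0 L (fun _ => true) hcert hadm hflat (List.all_eq_true.2 fun _ _ => rfl) hscan A B C hS

/-- **Dead-list-free capstone, two selections** (the root computation split over two kernel files; the selections jointly cover every listed shape).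
[cite: CohnKleinbergSzegedyUmans2005, Def. 5.1, Thm. 5.5] -/
theorem volume_le_of_scan_or_nodead (hn : Fintype.card H = n) (hn0 : n ≠ 0) (L : List (List ℕ × List Shape)) (sel₁ sel₂ : Shape → Bool)
    (hcert : chunksOK (2 * n + 2) L = true) (hadm : ((flat L).all (adm n)) = true) (hflat : flat L = shapeList n)
    (hsel : ((flat L).all fun s => sel₁ s || sel₂ s) = true)
    (hscan₁ : scanFirstC n [] sel₁ L = true) (hscan₂ : scanFirstC n [] sel₂ L = true)
    {m : ℕ} (A B C : Fin m → Finset H) (hS : IsSTPP A B C) : ∑ i, #(A i) * #(B i) * #(C i) ≤ n :=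
  volume_le_of_scan_sel_nodead hn hn0 L (fun s => sel₁ s || sel₂ s) hcert hadm hflat hsel (scanFirstC_or L hscan₁ hscan₂) A B C hS

end Summit.MatrixMultiplication.OmegaCensus.KLister
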